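import Literature.NumberTheory.EllipticCurves.CasselsTateGeneralCaseKernel
import Literature.NumberTheory.EllipticCurves.BSDShaCasselsTateLevelwise
import HarnessLib

/-!
# The Cassels–Tate pairing at a fixed level: assembly of `IsLevelPairing` from the general case

Topic `NumberTheory/EllipticCurves`; namespace `Literature.NumberTheory.EllipticCurves`. Definitions with
bodies and theorems only: **no named fact is introduced** (D-0026).

The tree reduces the fact `WeierstrassCurve.exists_casselsTate_pairing` (Silverman, *AEC*, X.4.14) to
the FIXED-LEVEL statement (`WeierstrassCurve.exists_casselsTate_pairing_of_levelwise`,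
`BSDShaCasselsTateLevelwise.lean`): for every elliptic curve and every prime power `q`, an alternating
bi-additive pairing `B_q : Ш(E/K)[q] × Ш(E/K)[q] → ℚ/ℤ` whose kernel is `Ш[q] ∩ qШ`
(`Literature.GroupTheory.FiniteAbelian.IsLevelPairing`).  This file assembles such a `B_m` at ANY level
`m` from the general case of Milne's construction (`CasselsTateGeneralCase*.lean`:
`ctGeneralFun : H¹(K, E)² → ℤ/m²`, bi-additive on `Ш[m]²`, kernel theorem
`exists_mem_sha_smul_eq_iff_forall_ctGeneralFun_eq_zero`), composed with the embedding
`ℤ/m² ↪ ℚ/ℤ`, `k ↦ k/m²` (`zmodToCircle`).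

**What the assembly consumes** (all as explicit hypotheses of `isLevelPairing_ctLevelPairing`; the list
is, by this theorem, the COMPLETE list of inputs still separating the tree from the Cassels–Tate fact at
level `m`, besides the Weil pairing `e` on `E[m²]`, which the tree HAS, `exists_weilPairing_holds`):

* on the family `inv : LocalInvariants K (m * m)` of local invariants at level `m²`:
  `hPT' : inv.SumInvLocalizationEqZero` (reciprocity for `H²(K, μ_{m²})`, Milne I 4.10(b)/A.7);
* `hH3` — `Ш³(K, μ_{m²}) = 0` (Milne I Thm. 4.10(c));
* `hfin` — finite support of the local terms of every general-case datum (unramified computation);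
* `hPTc` — Poitou–Tate for `Ш²(K, E[m])` in cochain form (Milne I Thm. 4.10 for `M = E[m]`);
* `h615` — the conclusion of Milne I Lemma 6.15 for all finite `S ⊇ S₀` (tree: `CasselsTateLemma615` +
  `CasselsTateLemma615LocalInputs`, from Poitou–Tate exactness at `∏_{v∈S} H¹(K_v, E[m])`, injectivity of
  the `inv_v` and Tate's local Euler characteristic formula);
* `hct_alt` — **the pairing is alternating on `Ш[m]`**: `⟨a, a⟩ = 0` (Cassels 1962 for elliptic curves;
  Milne I Rem. 6.11 / Poonen–Stoll 1999 for principal polarisations from a `K`-rational divisor). This is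
  NOT proved in the tree and is an input here.

## References

* [MilneADT2006] J. S. Milne, *Arithmetic Duality Theorems*, 2nd ed. (2006), Ch. I §6, Prop. 6.9,
  Thm. 6.13(a), Rem. 6.11; Thm. 4.10.
* [SilvermanAEC2009] J. H. Silverman, *The Arithmetic of Elliptic Curves*, 2nd ed. (2009), Thm. X.4.14.
-/

noncomputable section

open scoped Classical
open scoped AddSubgroup

universe u

namespace Literature.NumberTheory.EllipticCurves

open CategoryTheory _root_.WeierstrassCurve Field Function NumberField
open Literature.NumberTheory.GaloisRepresentations Literature.NumberTheory.GaloisCohomology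
open Literature.NumberTheory.GaloisRepresentations.DiscreteGaloisModule (mu MuCarrier pairing)
open Literature.GroupTheory.FiniteAbelian
open scoped ContRepresentation

-- Cup products need `LocallyCompactSpace Γ`; as in the tree's cup-product files, the compactness of
-- absolute Galois groups is a local instance only.
attribute [local instance] absoluteGaloisGroup_compactSpace

-- `char K_v = 0` for the completions of a number field (the tree's theorem `charZero_placeCompletion`;
-- local instance, no override).
attribute [local instance] charZero_placeCompletion

/-! ## The embedding `ℤ/N ↪ ℚ/ℤ` -/

section Circle

variable (N : ℕ) [NeZero N]

/-- `1/N ∈ ℚ/ℤ` has order `N`. [folklore] -/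
theorem addOrderOf_one_div_natCast : addOrderOf ((((1 : ℚ) / N : ℚ)) : AddCircle (1 : ℚ)) = N := by
  haveI : Fact ((0 : ℚ) < 1) := ⟨one_pos⟩
  exact AddCircle.addOrderOf_period_div (NeZero.pos N)

/-- **The embedding `ℤ/N ↪ ℚ/ℤ = AddCircle (1 : ℚ)`, `k ↦ k/N`.** [folklore] -/
def zmodToCircle : ZMod N →+ AddCircle (1 : ℚ) :=
  ZMod.lift N ⟨zmultiplesHom (AddCircle (1 : ℚ)) ((((1 : ℚ) / N : ℚ)) : AddCircle (1 : ℚ)), by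
    simp only [zmultiplesHom_apply]
    exact addOrderOf_dvd_iff_zsmul_eq_zero.mp (by rw [addOrderOf_one_div_natCast N])⟩

/-- `zmodToCircle N k = k • (1/N)`. [folklore] -/
theorem zmodToCircle_intCast (k : ℤ) :
    zmodToCircle N (k : ZMod N) = k • ((((1 : ℚ) / N : ℚ)) : AddCircle (1 : ℚ)) := by
  simp [zmodToCircle]

/-- `ℤ/N → ℚ/ℤ`, `k ↦ k/N`, is injective. [folklore] -/
theorem zmodToCircle_injective : Injective (zmodToCircle N) := by
  rw [injective_iff_map_eq_zero]
  intro k hk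
  obtain ⟨j, rfl⟩ := ZMod.intCast_surjective k
  rw [zmodToCircle_intCast] at hk
  have hdvd : (N : ℤ) ∣ j := by
    have h := addOrderOf_dvd_iff_zsmul_eq_zero.mpr hk
    rwa [addOrderOf_one_div_natCast] at h
  exact (ZMod.intCast_zmod_eq_zero_iff_dvd j N).mpr hdvd

end Circle

/-! ## The level-`m` pairing on `Ш(E/K)[m]` -/

section Level

variable {K : Type u} [Field K] [NumberField K] (W : WeierstrassCurve K) (m : ℕ) [NeZero m]
variable (e : geomTorsion W ((m * m : ℕ) : ℤ) → geomTorsion W ((m * m : ℕ) : ℤ) → AlgebraicClosure K)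
  (hμ : ∀ S T, e S T ^ (m * m) = 1)
  (hadd₁ : ∀ S₁ S₂ T, e (S₁ + S₂) T = e S₁ T * e S₂ T)
  (hadd₂ : ∀ S T₁ T₂, e S (T₁ + T₂) = e S T₁ * e S T₂)
  (hgal : ∀ (σ : absoluteGaloisGroup K) (S T : geomTorsion W ((m * m : ℕ) : ℤ)),
    σ • e S T = e (σ • S) (σ • T))
variable (inv : LocalInvariants K (m * m))

/-- The class in `H¹(K, E)` underlying an element of `Ш(E/K)[m]`. [folklore] -/
abbrev shaTorsionVal (x : (W.sha)[m]) : W.galH1 := ((x : W.sha) : W.galH1)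

omit [NeZero m] in
/-- It lies in `Ш(E/K)`. [folklore] -/
theorem shaTorsionVal_mem (x : (W.sha)[m]) : shaTorsionVal W m x ∈ W.sha := (x : W.sha).2

omit [NeZero m] in
/-- It is killed by `m`. [folklore] -/
theorem zsmul_shaTorsionVal (x : (W.sha)[m]) : (m : ℤ) • shaTorsionVal W m x = 0 := by
  have h1 : (m • x : (W.sha)[m]) = 0 := AddSubgroup.torsionBy.nsmul x
  have h2 : m • shaTorsionVal W m x = 0 := by
    have h := congrArg (fun z : (W.sha)[m] => ((z : W.sha) : W.galH1)) h1
    simpa only [AddSubgroupClass.coe_nsmul, AddSubgroup.coe_nsmul, ZeroMemClass.coe_zero] using h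
  rw [natCast_zsmul]
  exact h2

omit [NeZero m] in
/-- `shaTorsionVal` is additive. [folklore] -/
theorem shaTorsionVal_add (x y : (W.sha)[m]) :
    shaTorsionVal W m (x + y) = shaTorsionVal W m x + shaTorsionVal W m y := rfl

omit [NeZero m] in
/-- An `m`-torsion class of `Ш(E/K)` as an element of `Ш(E/K)[m]`. [folklore] -/
theorem mem_torsionBy_sha_of_zsmul_eq_zero {a : W.galH1} (ha : a ∈ W.sha) (hma : (m : ℤ) • a = 0) :
    (⟨a, ha⟩ : W.sha) ∈ (W.sha)[m] :=
  AddSubgroup.torsionBy.nsmul_iff.2 (Subtype.ext (by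
    rw [AddSubgroup.coe_nsmul, ZeroMemClass.coe_zero, ← natCast_zsmul]
    exact hma))

variable (halt : ∀ T, e T T = 1) (hPT' : inv.SumInvLocalizationEqZero)
  (hH3 : ∀ c : galoisCohomology (mu K (m * m)) 3,
    (∀ v : Place K, galoisCohomology.localization (mu K (m * m)) v 3 c = 0) → c = 0)
  (hfin : ∀ D : GeneralCaseData W m e hμ hadd₁ hadd₂ hgal, ∃ S : Finset (Place K), ∀ v ∉ S, D.localTerm inv v = 0)

/-- **The Cassels–Tate pairing at level `m` on `Ш(E/K)[m]` with values in `ℚ/ℤ`**: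
`B_m(x, y) = ⟨x, y⟩ / m² ∈ ℚ/ℤ`, the general-case pairing `ctGeneralFun` (values in `ℤ/m²`) composed
with `ℤ/m² ↪ ℚ/ℤ`; bi-additive by `ctGeneralFun_add_left/right_of_mem_sha` (inputs `halt`, `hPT'`,
`hH3`, `hfin`). [cite: MilneADT2006, Ch. I §6, Prop. 6.9] -/
def ctLevelPairing [W.IsElliptic] : (W.sha)[m] →+ (W.sha)[m] →+ AddCircle (1 : ℚ) :=
  AddMonoidHom.mk'
    (fun x => AddMonoidHom.mk'
      (fun y => zmodToCircle (m * m)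
        (ctGeneralFun W m e hμ hadd₁ hadd₂ hgal inv (shaTorsionVal W m x) (shaTorsionVal W m y)))
      (fun y₁ y₂ => by
        rw [← map_add, shaTorsionVal_add]
        exact congrArg _ (ctGeneralFun_add_right_of_mem_sha inv halt hPT' hH3 hfin
          (shaTorsionVal_mem W m x) (zsmul_shaTorsionVal W m x) (shaTorsionVal_mem W m y₁)
          (zsmul_shaTorsionVal W m y₁) (shaTorsionVal_mem W m y₂) (zsmul_shaTorsionVal W m y₂))))
    (fun x₁ x₂ => by
      ext y
      change zmodToCircle (m * m)
          (ctGeneralFun W m e hμ hadd₁ hadd₂ hgal inv (shaTorsionVal W m (x₁ + x₂)) (shaTorsionVal W m y)) =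
        zmodToCircle (m * m) (ctGeneralFun W m e hμ hadd₁ hadd₂ hgal inv (shaTorsionVal W m x₁) (shaTorsionVal W m y)) +
          zmodToCircle (m * m) (ctGeneralFun W m e hμ hadd₁ hadd₂ hgal inv (shaTorsionVal W m x₂) (shaTorsionVal W m y))
      rw [← map_add, shaTorsionVal_add]
      exact congrArg _ (ctGeneralFun_add_left_of_mem_sha inv halt hPT' hH3 hfin
        (shaTorsionVal_mem W m x₁) (zsmul_shaTorsionVal W m x₁) (shaTorsionVal_mem W m x₂)
        (zsmul_shaTorsionVal W m x₂) (shaTorsionVal_mem W m y) (zsmul_shaTorsionVal W m y)))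

/-- Unfolding `ctLevelPairing`. [folklore] -/
theorem ctLevelPairing_apply [W.IsElliptic] (x y : (W.sha)[m]) :
    ctLevelPairing W m e hμ hadd₁ hadd₂ hgal inv halt hPT' hH3 hfin x y =
      zmodToCircle (m * m) (ctGeneralFun W m e hμ hadd₁ hadd₂ hgal inv (shaTorsionVal W m x) (shaTorsionVal W m y)) :=
  rfl

/-- **The level-`m` Cassels–Tate pairing is a level pairing** (`IsLevelPairing m`: alternating, and
the kernel on `Ш[m]` is `Ш[m] ∩ mШ`), granted — besides `halt`, `hPT'`, `hH3`, `hfin` — the Poitou–Tate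
input `hPTc` for `Ш²(K, E[m])`, the Lemma-6.15 input `h615`, and the alternation `hct_alt` of the
general-case pairing on `Ш[m]` (module docstring).  The kernel clause is
`exists_mem_sha_smul_eq_of_forall_ctGeneralFun_eq_zero` (Milne I Thm. 6.13(a)) and
`ctGeneralFun_eq_zero_of_exists_mem_sha_smul_eq`, transported along the injection `ℤ/m² ↪ ℚ/ℤ`.
Feeding this, for all prime powers `m = p^k`, to the tree's
`WeierstrassCurve.exists_casselsTate_pairing_of_levelwise` yields
`WeierstrassCurve.exists_casselsTate_pairing`. [cite: MilneADT2006, Ch. I §6, Thm. 6.13(a)]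
[cite: SilvermanAEC2009, Thm. X.4.14] -/
theorem isLevelPairing_ctLevelPairing [W.IsElliptic]
    (hPTc : ∀ f : contTwoCocycles (W.torsionGaloisModule (m : ℤ)).toTopRep,
      (∀ g : contOneCocycles (W.torsionGaloisModule (m : ℤ)).toTopRep,
        (∀ v : Place K, locClass (W.torsionGaloisModule (m : ℤ)) (Place.Completion v)
          (resOne (W.torsionGaloisModule (m : ℤ)) (Place.Completion v) g) = 0) →
        ∃ (C : PTChoice W m e hμ hadd₁ hadd₂ hgal f g) (S : Finset (Place K)),
          (∀ v ∉ S, C.localTerm inv v = 0) ∧ ∑ v ∈ S, C.localTerm inv v = 0) →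
      twoCocycleClass _ f = 0)
    (S₀ : Finset (Place K))
    (h615 : ∀ S : Finset (Place K), S₀ ⊆ S → ∀ x : LocalClasses W m S,
      (∀ b' ∈ selmerGroup W (m : ℤ), sumPairing W m e hμ hadd₁ hadd₂ hgal inv S x (locS W m S b') = 0) →
        ∃ b₀ ∈ kummerOutside W m S, ∀ v : S,
          x v - locS W m S b₀ v ∈ W.kummerLocalConditionAt (m : ℤ) (Place.Completion (v : Place K)))
    (hct_alt : ∀ a ∈ W.sha, (m : ℤ) • a = 0 → ctGeneralFun W m e hμ hadd₁ hadd₂ hgal inv a a = 0) :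
    IsLevelPairing m (ctLevelPairing W m e hμ hadd₁ hadd₂ hgal inv halt hPT' hH3 hfin) := by
  refine ⟨fun x => ?_, fun x => ⟨fun h => ?_, fun hz y => ?_⟩⟩
  · rw [ctLevelPairing_apply, hct_alt _ (shaTorsionVal_mem W m x) (zsmul_shaTorsionVal W m x), map_zero]
  · have horth : ∀ a' ∈ W.sha, (m : ℤ) • a' = 0 →
        ctGeneralFun W m e hμ hadd₁ hadd₂ hgal inv (shaTorsionVal W m x) a' = 0 := fun a' ha' hma' => by
      have hy := h ⟨⟨a', ha'⟩, mem_torsionBy_sha_of_zsmul_eq_zero W m ha' hma'⟩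
      rw [ctLevelPairing_apply] at hy
      exact zmodToCircle_injective _ (hy.trans (map_zero _).symm)
    obtain ⟨a₀, ha₀, h₀⟩ := exists_mem_sha_smul_eq_of_forall_ctGeneralFun_eq_zero inv halt hPT' hH3 hfin hPTc
      S₀ h615 (shaTorsionVal_mem W m x) (zsmul_shaTorsionVal W m x) horth
    refine ⟨⟨a₀, ha₀⟩, Subtype.ext ?_⟩
    rw [AddSubgroup.coe_nsmul]
    change m • a₀ = shaTorsionVal W m x
    rw [← natCast_zsmul]
    exact h₀
  · obtain ⟨z, hz⟩ := hz
    rw [ctLevelPairing_apply, ctGeneralFun_eq_zero_of_exists_mem_sha_smul_eq inv halt hPT' (zsmul_shaTorsionVal W m x)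
      ⟨(z : W.galH1), z.2, ?_⟩ (shaTorsionVal_mem W m y) (zsmul_shaTorsionVal W m y), map_zero]
    rw [natCast_zsmul, ← AddSubgroup.coe_nsmul, hz]

include halt hPT' hH3 hfin in
/-- **Existence form**: under the inputs of `isLevelPairing_ctLevelPairing`, a level pairing on
`Ш(E/K)[m]` exists (the hypothesis of `WeierstrassCurve.exists_casselsTate_pairing_of_levelwise` at
`m = p^k`). [cite: MilneADT2006, Ch. I §6, Thm. 6.13(a)] -/
theorem exists_isLevelPairing_of_generalCaseInputs [W.IsElliptic]
    (hPTc : ∀ f : contTwoCocycles (W.torsionGaloisModule (m : ℤ)).toTopRep,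
      (∀ g : contOneCocycles (W.torsionGaloisModule (m : ℤ)).toTopRep,
        (∀ v : Place K, locClass (W.torsionGaloisModule (m : ℤ)) (Place.Completion v)
          (resOne (W.torsionGaloisModule (m : ℤ)) (Place.Completion v) g) = 0) →
        ∃ (C : PTChoice W m e hμ hadd₁ hadd₂ hgal f g) (S : Finset (Place K)),
          (∀ v ∉ S, C.localTerm inv v = 0) ∧ ∑ v ∈ S, C.localTerm inv v = 0) →
      twoCocycleClass _ f = 0)
    (S₀ : Finset (Place K))
    (h615 : ∀ S : Finset (Place K), S₀ ⊆ S → ∀ x : LocalClasses W m S,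
      (∀ b' ∈ selmerGroup W (m : ℤ), sumPairing W m e hμ hadd₁ hadd₂ hgal inv S x (locS W m S b') = 0) →
        ∃ b₀ ∈ kummerOutside W m S, ∀ v : S,
          x v - locS W m S b₀ v ∈ W.kummerLocalConditionAt (m : ℤ) (Place.Completion (v : Place K)))
    (hct_alt : ∀ a ∈ W.sha, (m : ℤ) • a = 0 → ctGeneralFun W m e hμ hadd₁ hadd₂ hgal inv a a = 0) :
    ∃ B : (W.sha)[m] →+ (W.sha)[m] →+ AddCircle (1 : ℚ), IsLevelPairing m B :=
  ⟨_, isLevelPairing_ctLevelPairing W m e hμ hadd₁ hadd₂ hgal inv halt hPT' hH3 hfin hPTc S₀ h615 hct_alt⟩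

end Level

end Literature.NumberTheory.EllipticCurves

end
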